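import Summits.Ventures.Crystal3D.Bulk.GapFaceCorners
import Literature.Geometry.DiscreteGeometry.SphericalCodeHemisphere
import HarnessLib

/-!
# L3 for the GAP census: the ACTIVE vertices of the tight map (non-rattler shell balls and the
# hole) lie in no closed hemisphere, and the centre is interior to their convex hull

HONEST FRAMING. Part of the venture `Summits/Ventures/Crystal3D` (cell `pub-crystal3d`, phase 2;
seat p3). Row L3 of the cell's `phase2/ENV-CENSUS/DESIGN-L12-THEORY.md` §P-L3 ("`V(T′)` lies in
no closed hemisphere"), the standing input of LEMMA L there (convexity of the faces of the tight
graph: the hull of the ACTIVE directions is a geodesic triangulation all of whose vertices lie on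
face boundaries). The tree already has the statement for the twelve SHELL directions (row E6,
`IsGapConfig.exists_shell_inner_neg`, a cap-area count); the point of L3 is that it survives the
deletion of the rattlers (shell balls with no tight partner), which is NOT a counting fact. The
cell file proves it by a latitude argument on a face containing a hemisphere; this file proves
it WITHOUT faces, from the two no-half-plane rows P-L2(a) alone (`CensusRows.exists_inner_pos_shell`
at a shell ball with a tight partner, `CensusRows.exists_inner_pos_intruder` at the hole):

* **`IsGapConfig.exists_active_inner_neg_of_noHalfPlane`** — if every active vertex admits no
  closed tangent half-plane containing all its tight partners, then for every `v ≠ 0` some active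
  direction `gapDir c i` has `⟪v, gapDir c i⟫ < 0`. PROOF: otherwise let the active vertex `i`
  MINIMISE `a := ⟪v, uᵢ⟫ ≥ 0` (`uⱼ = gapDir c j`) and put `n := a • uᵢ − v`, a tangent vector at
  `uᵢ`; `n ≠ 0` because `i` has a tight partner `j` (active, so `⟪v, uⱼ⟫ ≥ a`, while
  `⟪uᵢ, uⱼ⟫ < 1`); and every tight partner `j` of `i` has
  `⟪n, c j − c 0⟫ = ‖c j − c 0‖ · (a⟪uᵢ, uⱼ⟫ − ⟪v, uⱼ⟫) ≤ ‖c j − c 0‖ · a · (⟪uᵢ, uⱼ⟫ − 1) ≤ 0`,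
  contradicting P-L2(a) at `i`.
* **`CensusRows.exists_active_inner_neg`** — hence at every configuration satisfying the census
  rows; **`CensusRows.zero_mem_interior_convexHull_activeDirs`** — so `0` is interior to the
  convex hull of the active directions (tree Hahn–Banach lemma
  `zero_mem_interior_convexHull_of_forall_exists_inner_neg`), the hypothesis under which the
  hull-fan machinery `Bulk/HullRotSys*.lean` applies to the active directions.

Nothing numerical; nothing is claimed about GAP(1.26).
-/

noncomputable section

open scoped BigOperators InnerProductSpace
open Finset

namespace Summit.Ventures.Crystal3D

open Literature.Geometry.DiscreteGeometry

variable {c : Fin 14 → EuclideanSpace ℝ (Fin 3)}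

/-! ## Directions and offsets -/

/-- The offset of ball `j ≠ 0` from ball `0` has positive norm (balls are distinct). -/
theorem IsGapConfig.norm_sub_pos (hc : IsGapConfig c) {j : Fin 14} (hj0 : j ≠ 0) :
    0 < ‖c j - c 0‖ :=
  norm_pos_iff.2 (sub_ne_zero.2 fun h => hj0 (hc.injective h))

/-- A tight partner of an active vertex is itself active. -/
theorem mem_activeVertices_of_mem_tightNbrs {i j : Fin 14} (hi0 : i ≠ 0)
    (hj : j ∈ tightNbrs c i) : j ∈ activeVertices c := by
  obtain ⟨hj0, hji, hd⟩ := mem_tightNbrs.1 hj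
  refine mem_activeVertices.2 ⟨hj0, ⟨i, mem_tightNbrs.2 ⟨hi0, Ne.symm hji, ?_⟩⟩⟩
  rw [dist_comm]; exact hd

/-! ## L3 from the no-half-plane rows -/

/-- **L3 (active vertices lie in no closed hemisphere), from P-L2(a).** Let `c` be admissible
with `intruderDist c < 2` and at least one active vertex, and suppose that at EVERY active
vertex `i` (ball `≠ 0` with a tight partner) no closed tangent half-plane at `gapDir c i`
contains all tight partner offsets: for every `n ≠ 0` with `⟪c i − c 0, n⟫ = 0` some tight
partner `j` has `0 < ⟪n, c j − c 0⟫`. Then for every `v ≠ 0` some active direction has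
`⟪v, gapDir c i⟫ < 0`. -/
theorem IsGapConfig.exists_active_inner_neg_of_noHalfPlane (hc : IsGapConfig c)
    (hD : intruderDist c < 2) (hne : (activeVertices c).Nonempty)
    (hP : ∀ i ∈ activeVertices c, ∀ n : EuclideanSpace ℝ (Fin 3), n ≠ 0 →
      ⟪c i - c 0, n⟫_ℝ = 0 → ∃ j ∈ tightNbrs c i, 0 < ⟪n, c j - c 0⟫_ℝ)
    {v : EuclideanSpace ℝ (Fin 3)} (hv : v ≠ 0) :
    ∃ i ∈ activeVertices c, ⟪v, gapDir c i⟫_ℝ < 0 := by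
  by_contra hcon
  push Not at hcon
  -- the active vertex minimising `⟪v, u_i⟫`
  obtain ⟨i, hi, hmin⟩ := exists_min_image (activeVertices c) (fun i => ⟪v, gapDir c i⟫_ℝ) hne
  obtain ⟨hi0, hiN⟩ := mem_activeVertices.1 hi
  set a : ℝ := ⟪v, gapDir c i⟫_ℝ with hadef
  have ha : 0 ≤ a := hcon i hi
  have hu : ‖gapDir c i‖ = 1 := hc.norm_gapDir hi0
  have huu : ⟪gapDir c i, gapDir c i⟫_ℝ = 1 := by
    rw [real_inner_self_eq_norm_sq, hu, one_pow]
  -- the tangent vector `n := a • u_i − v`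
  set n : EuclideanSpace ℝ (Fin 3) := a • gapDir c i - v with hndef
  have hci := hc.sub_eq_norm_smul_gapDir hi0
  have htan : ⟪c i - c 0, n⟫_ℝ = 0 := by
    rw [hci, hndef, real_inner_smul_left, inner_sub_right, real_inner_smul_right, huu,
      real_inner_comm, ← hadef]
    ring
  -- every tight partner `j` of `i` is active, hence `⟪v, u_j⟫ ≥ a`, and `⟪n, c j − c 0⟫ ≤ 0`
  have hkey : ∀ j ∈ tightNbrs c i, ⟪n, c j - c 0⟫_ℝ ≤ 0 := by
    intro j hj
    obtain ⟨hj0, hji, -⟩ := mem_tightNbrs.1 hj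
    have hja : a ≤ ⟪v, gapDir c j⟫_ℝ := hmin j (mem_activeVertices_of_mem_tightNbrs hi0 hj)
    have hcj := hc.sub_eq_norm_smul_gapDir hj0
    have hrj := hc.norm_sub_pos hj0
    have h1 : ⟪gapDir c i, gapDir c j⟫_ℝ ≤ 1 := by
      have := real_inner_le_norm (gapDir c i) (gapDir c j)
      rwa [hu, hc.norm_gapDir hj0, one_mul] at this
    have hinner : ⟪n, c j - c 0⟫_ℝ =
        ‖c j - c 0‖ * (a * ⟪gapDir c i, gapDir c j⟫_ℝ - ⟪v, gapDir c j⟫_ℝ) := by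
      conv_lhs => rw [hcj]
      rw [real_inner_smul_right, hndef, inner_sub_left, real_inner_smul_left]
    rw [hinner]
    have h2 : a * ⟪gapDir c i, gapDir c j⟫_ℝ - ⟪v, gapDir c j⟫_ℝ ≤ 0 := by nlinarith
    exact mul_nonpos_of_nonneg_of_nonpos hrj.le h2
  -- `n ≠ 0`: `i` has a tight partner `j`, with `⟪u_i, u_j⟫ < 1`
  have hn : n ≠ 0 := by
    obtain ⟨j, hj⟩ := hiN
    obtain ⟨hj0, hji, -⟩ := mem_tightNbrs.1 hj
    have hja : a ≤ ⟪v, gapDir c j⟫_ℝ := hmin j (mem_activeVertices_of_mem_tightNbrs hi0 hj)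
    have hlt : ⟪gapDir c i, gapDir c j⟫_ℝ < 1 :=
      (hc.inner_gapDir_le hi0 hj0 (Ne.symm hji)).trans_lt (tightLevel_lt_one hD i j)
    intro hn0
    have hv' : v = a • gapDir c i := by
      rw [hndef, sub_eq_zero] at hn0; exact hn0.symm
    -- then `a > 0` (as `v ≠ 0`) and `⟪v, u_j⟫ = a ⟪u_i, u_j⟫ < a`
    have ha0 : 0 < a := by
      rcases ha.lt_or_eq with h | h
      · exact h
      · exfalso; apply hv; rw [hv', ← h, zero_smul]
    have : ⟪v, gapDir c j⟫_ℝ < a := by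
      rw [hv', real_inner_smul_left]
      nlinarith
    linarith
  obtain ⟨j, hj, hpos⟩ := hP i hi n hn htan
  linarith [hkey j hj]

/-! ## L3 at a configuration satisfying the census rows -/

/-- The hole is an active vertex: it touches at least three shell balls. -/
theorem CensusRows.thirteen_mem_activeVertices (h : CensusRows c) : (13 : Fin 14) ∈ activeVertices c := by
  refine mem_activeVertices.2 ⟨by decide, ?_⟩
  have h3 := h.three_le_card_intruderContacts
  obtain ⟨j, hj⟩ : (univ.filter fun j : Fin 14 => j ≠ 0 ∧ j ≠ 13 ∧ dist (c 13) (c j) = 1).Nonempty := by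
    rw [← Finset.card_pos]; omega
  obtain ⟨hj0, hj13, hd⟩ := (mem_filter.1 hj).2
  exact ⟨j, mem_tightNbrs.2 ⟨hj0, hj13, hd⟩⟩

/-- P-L2(a) at every active vertex, in the `tightNbrs` phrasing (the two fields
`exists_inner_pos_shell`, `exists_inner_pos_intruder` of `CensusRows`). -/
theorem CensusRows.noHalfPlane_active (h : CensusRows c) {i : Fin 14} (hi : i ∈ activeVertices c)
    {n : EuclideanSpace ℝ (Fin 3)} (hn : n ≠ 0) (htan : ⟪c i - c 0, n⟫_ℝ = 0) :
    ∃ j ∈ tightNbrs c i, 0 < ⟪n, c j - c 0⟫_ℝ := by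
  obtain ⟨hi0, hiN⟩ := mem_activeVertices.1 hi
  by_cases hi13 : i = 13
  · subst hi13
    obtain ⟨j, hj0, hj13, hd, hpos⟩ := h.exists_inner_pos_intruder n hn htan
    exact ⟨j, mem_tightNbrs.2 ⟨hj0, hj13, hd⟩, hpos⟩
  · obtain ⟨j, hj⟩ := hiN
    obtain ⟨hj0, hji, hd⟩ := mem_tightNbrs.1 hj
    obtain ⟨k, hk0, hki, hdk, hpos⟩ :=
      h.exists_inner_pos_shell i hi0 hi13 ⟨j, hj0, hji, hd⟩ n hn htan
    exact ⟨k, mem_tightNbrs.2 ⟨hk0, hki, hdk⟩, hpos⟩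

/-- **L3.** At a configuration satisfying the census rows, the active vertices of the tight map
lie in no closed hemisphere: for every `v ≠ 0` some active direction has `⟪v, gapDir c i⟫ < 0`. -/
theorem CensusRows.exists_active_inner_neg (h : CensusRows c) {v : EuclideanSpace ℝ (Fin 3)}
    (hv : v ≠ 0) : ∃ i ∈ activeVertices c, ⟪v, gapDir c i⟫_ℝ < 0 :=
  h.isGapConfig.exists_active_inner_neg_of_noHalfPlane (by linarith [h.intruderDist_le])
    ⟨13, h.thirteen_mem_activeVertices⟩ (fun _ hi _ hn htan => h.noHalfPlane_active hi hn htan) hv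

/-- The same with the opposite sign: some active direction has `0 < ⟪v, gapDir c i⟫`. -/
theorem CensusRows.exists_active_inner_pos (h : CensusRows c) {v : EuclideanSpace ℝ (Fin 3)}
    (hv : v ≠ 0) : ∃ i ∈ activeVertices c, 0 < ⟪v, gapDir c i⟫_ℝ := by
  obtain ⟨i, hi, hlt⟩ := h.exists_active_inner_neg (neg_ne_zero.2 hv)
  exact ⟨i, hi, by rwa [inner_neg_left, neg_lt_zero] at hlt⟩

/-- **The centre is interior to the convex hull of the ACTIVE directions** (tree Hahn–Banach
lemma): the standing hypothesis of the hull-fan machinery (`Bulk/HullRotSys*.lean`) for the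
active directions — the triangulation `D°` of LEMMA L. -/
theorem CensusRows.zero_mem_interior_convexHull_activeDirs (h : CensusRows c) :
    (0 : EuclideanSpace ℝ (Fin 3)) ∈ interior (convexHull ℝ
      (((activeVertices c).image (gapDir c) : Finset (EuclideanSpace ℝ (Fin 3))) :
        Set (EuclideanSpace ℝ (Fin 3)))) := by
  classical
  refine zero_mem_interior_convexHull_of_forall_exists_inner_neg
    ⟨gapDir c 13, mem_image_of_mem _ h.thirteen_mem_activeVertices⟩ fun v hv => ?_
  obtain ⟨i, hi, hlt⟩ := h.exists_active_inner_neg hv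
  exact ⟨gapDir c i, mem_image_of_mem _ hi, hlt⟩

/-- The active directions are unit vectors (for the record, next to the hull hypothesis). -/
theorem CensusRows.norm_of_mem_activeDirs (h : CensusRows c) {y : EuclideanSpace ℝ (Fin 3)}
    (hy : y ∈ (activeVertices c).image (gapDir c)) : ‖y‖ = 1 := by
  obtain ⟨i, hi, rfl⟩ := mem_image.1 hy
  exact h.isGapConfig.norm_gapDir (mem_activeVertices.1 hi).1

end Summit.Ventures.Crystal3D

end
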